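import Summits.Parity.GeneralizedHardyLittlewood.Theorems.PrimeLevelFamEdgeMomentsBeyondDiagonalLayersFormReductionZero
import Summits.Parity.GeneralizedHardyLittlewood.Theorems.PrimeLevelFamEdgeMomentsBeyondDiagonalLayersClassSplit
import HarnessLib

/-!
# Route `PrimeLevelFamEdge`, crux K_A `MomentsBeyondDiagonal` (stmt-Parity-20007), line «petersson_layers» v4:
# `stub_farP` REDUCED TO THE CLASS SUMS of the leading-order forms (assembly steps E1–E3 composed)

`…LayersFormReductionZero.subFar_rhoP_of_form_bound_zero` (stub ⟸ the `k = 0` forms) composed with the class split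
`…LayersClassSplit.norm_sum_four_kloosterman_le_sum_classes` block by block:
* **`subFar_rhoP_of_classSum_bound`**: `SubFar rhoP` (the registered signature of `stub_farP`) ⟸ on a window
  `(1, Δ₀] ⊆ (1, 101/100]`, for every admissible `P` and `Δ'`: ONE `δ > 0`, ONE `η ∈ (0, 1/100]` and, per order `(i,j)`,
  constants `A, q₀` such that for all primes `q ≥ q₀` (`q̂^{Δ'} ∉ ℕ`) and layers `⌊q̂^{ρ_P}⌋ < r ≤ ⌊q̂^{ρ_W}⌋`
  `Σ_{d₁,d₂ ≤ M} Σ_{classes (s₁,t₁,s₂,t₂)} (φ(qr)/φ(qr/g)) · ‖class form(d₁,d₂; s₁,t₁,s₂,t₂)‖ ≤ A · q̂^{−δ} · (qr)² · r⁻¹`,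
  where the class form is EXACTLY the dilated bilinear Kloosterman form bounded in closed form by
  `…LayersClassBound(All).norm_classForm_le_of_pascadi(_all)(')` (Pascadi, CONDITIONAL) and
  `…LayersClassBoundFourier.norm_classForm_le_dilatedFourier` (unconditional), and the class sum is controlled by
  `…LayersClassCount.sum_rpow_neg_sixth_factored_le`.
What remains of `stub_farP` after this file is the exponent bookkeeping summing those closed-form bounds (census step E5b on the
crux item) and the final instantiation (E7).  Proof only (def-free helper); K_A NOT proved; nothing about Landau–Siegel zeros.
-/

noncomputable section

open scoped Real Nat
open Complex Finset Polynomial MeasureTheory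
open Literature.NumberTheory.LFunctions

namespace Summit.Parity.GeneralizedHardyLittlewood.Theorems.MomentsBeyondDiagonal.Layers

open Summit.Parity.GeneralizedHardyLittlewood.Theorems.PrimeLevelFamEdgeIdeaDeltas.PeterssonLayers

/-- **`stub_farP`'s signature `SubFar rhoP` from a bound on the CLASS SUMS of the leading-order forms.** [folklore] -/
theorem subFar_rhoP_of_classSum_bound {Δ₀ : ℝ} (hΔ₀ : 1 < Δ₀) (hΔ₀' : Δ₀ ≤ 101 / 100)
    (h : ∀ P : ℝ[X], KMV2000.Admissible P → ∀ Δ' : ℝ, 1 < Δ' → Δ' ≤ Δ₀ →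
      ∃ δ η : ℝ, 0 < δ ∧ 0 < η ∧ η ≤ 1 / 100 ∧ ∀ i j : ℕ, ∃ A : ℝ, ∃ q₀ : ℕ,
        ∀ (q : ℕ) [NeZero q], q.Prime → q₀ ≤ q → (∀ n : ℕ, (n : ℝ) ≠ KMV2000.qhat q ^ Δ') →
        ∀ (r : ℕ) [NeZero (q * r)], r ∈ Icc (layerCount q rhoP Δ' + 1) (layerCount q rhoWeil Δ') →
          ∑ d₁ ∈ Icc 1 ⌊KMV2000.qhat q ^ Δ'⌋₊, ∑ d₂ ∈ Icc 1 ⌊KMV2000.qhat q ^ Δ'⌋₊,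
          ∑ s₁ ∈ (Icc 1 (⌊KMV2000.qhat q ^ Δ'⌋₊ / d₁)).filter (fun s ↦ s ∈ Nat.factoredNumbers (q * r).primeFactors),
          ∑ t₁ ∈ (Icc 1 (q ^ 2 / d₁)).filter (fun s ↦ s ∈ Nat.factoredNumbers (q * r).primeFactors),
          ∑ s₂ ∈ (Icc 1 (⌊KMV2000.qhat q ^ Δ'⌋₊ / d₂)).filter (fun s ↦ s ∈ Nat.factoredNumbers (q * r).primeFactors),
          ∑ t₂ ∈ (Icc 1 (q ^ 2 / d₂)).filter (fun s ↦ s ∈ Nat.factoredNumbers (q * r).primeFactors),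
            (((q * r).totient : ℝ) / (((q * r) / Nat.gcd (Nat.gcd (s₁ * t₁) (s₂ * t₂)) (q * r)).totient : ℝ)) *
            ‖∑ f₁ ∈ Icc 1 (⌊KMV2000.qhat q ^ Δ'⌋₊ / d₁ / s₁), ∑ h₁ ∈ Icc 1 (q ^ 2 / d₁ / t₁),
              ∑ f₂ ∈ Icc 1 (⌊KMV2000.qhat q ^ Δ'⌋₊ / d₂ / s₂), ∑ h₂ ∈ Icc 1 (q ^ 2 / d₂ / t₂),
                (if Nat.Coprime f₁ (q * r) ∧ Nat.Coprime f₂ (q * r) then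
                    (KMV2000.mollifierCoeff P (KMV2000.qhat q ^ Δ') (d₁ * (s₁ * f₁)) : ℂ) *
                      (KMV2000.mollifierCoeff P (KMV2000.qhat q ^ Δ') (d₂ * (s₂ * f₂)) : ℂ) *
                      ((Real.sqrt ((s₁ * f₁ : ℕ) : ℝ) * Real.sqrt ((s₂ * f₂ : ℕ) : ℝ) : ℝ) : ℂ) else 0) *
                  (if Nat.Coprime h₁ (q * r) ∧ Nat.Coprime h₂ (q * r) then
                      (if d₁ * (t₁ * h₁) * (d₂ * (t₂ * h₂)) ≤ ⌈KMV2000.qhat q ^ (2 + η)⌉₊ then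
                          ((((((d₁ * (t₁ * h₁) : ℕ) : ℝ) * ((d₂ * (t₂ * h₂) : ℕ) : ℝ)) ^ (-(1 / 2 : ℝ)) : ℝ) : ℂ) *
                            afeW (KMV2000.qhat q) i j (d₁ * (t₁ * h₁)) (d₂ * (t₂ * h₂))) else 0) *
                        ((Real.sqrt ((t₁ * h₁ : ℕ) : ℝ) * Real.sqrt ((t₂ * h₂ : ℕ) : ℝ) : ℝ) : ℂ) else 0) *
                  @kloostermanSum ((q * r) / Nat.gcd (Nat.gcd (s₁ * t₁) (s₂ * t₂)) (q * r))
                    (neZero_div_classGcd (q * r) (s₁ * t₁) (s₂ * t₂))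
                    ((s₁ * t₁ / Nat.gcd (Nat.gcd (s₁ * t₁) (s₂ * t₂)) (q * r) * (f₁ * f₂) : ℕ) :
                      ZMod ((q * r) / Nat.gcd (Nat.gcd (s₁ * t₁) (s₂ * t₂)) (q * r)))
                    ((s₂ * t₂ / Nat.gcd (Nat.gcd (s₁ * t₁) (s₂ * t₂)) (q * r) * (h₁ * h₂) : ℕ) :
                      ZMod ((q * r) / Nat.gcd (Nat.gcd (s₁ * t₁) (s₂ * t₂)) (q * r)))‖ ≤
            A * KMV2000.qhat q ^ (-δ) * ((q : ℝ) * r) ^ 2 * ((r : ℝ))⁻¹) :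
    SubFar rhoP := by
  refine subFar_rhoP_of_form_bound_zero hΔ₀ hΔ₀' fun P hP Δ' h1 h2 ↦ ?_
  obtain ⟨δ, η, hδ, hη, hη100, hij⟩ := h P hP Δ' h1 h2
  refine ⟨δ, η, hδ, hη, hη100, fun i j ↦ ?_⟩
  obtain ⟨A, q₀, hA⟩ := hij i j
  refine ⟨A, q₀, fun q _ hq hq₀ hM r _ hr ↦ ?_⟩
  refine le_trans (sum_le_sum fun d₁ _ ↦ sum_le_sum fun d₂ _ ↦ ?_) (hA q hq hq₀ hM r hr)
  exact norm_sum_four_kloosterman_le_sum_classes (c := q * r) (⌊KMV2000.qhat q ^ Δ'⌋₊ / d₁) (q ^ 2 / d₁)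
    (⌊KMV2000.qhat q ^ Δ'⌋₊ / d₂) (q ^ 2 / d₂)
    (fun m₁ m₂ ↦ (KMV2000.mollifierCoeff P (KMV2000.qhat q ^ Δ') (d₁ * m₁) : ℂ) *
      (KMV2000.mollifierCoeff P (KMV2000.qhat q ^ Δ') (d₂ * m₂) : ℂ) * ((Real.sqrt (m₁ : ℝ) * Real.sqrt (m₂ : ℝ) : ℝ) : ℂ))
    (fun n₁ n₂ ↦ (if d₁ * n₁ * (d₂ * n₂) ≤ ⌈KMV2000.qhat q ^ (2 + η)⌉₊ then
        ((((((d₁ * n₁ : ℕ) : ℝ) * ((d₂ * n₂ : ℕ) : ℝ)) ^ (-(1 / 2 : ℝ)) : ℝ) : ℂ) *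
          afeW (KMV2000.qhat q) i j (d₁ * n₁) (d₂ * n₂)) else 0) *
        ((Real.sqrt (n₁ : ℝ) * Real.sqrt (n₂ : ℝ) : ℝ) : ℂ))

end Summit.Parity.GeneralizedHardyLittlewood.Theorems.MomentsBeyondDiagonal.Layers

end
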